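import Literature.Geometry.Kaehler.AnalyticSetSingularLocusCodim
import Literature.Geometry.Kaehler.AnalyticSetRegularUnion
import HarnessLib

/-!
# Route HolomorphicityRate · crux `SuperThresholdRigidity` (stmt-HodgeConjecture-2737) · line `registered`
# · stub `stub_analyticOfRegularOffBad` — CLOSED, unconditional

The dimension-theoretic assembly step of the recognition half of the crux
`Summit.HodgeConjecture.HodgeConjecture.Theses.HolomorphicityRate.SuperThresholdRigidity`
(skeleton `Summits/HodgeConjecture/HodgeConjecture/Cruxes/SuperThresholdRigidity/Lines/birth.lean`,
stub `stub_analyticOfRegularOffBad`, registered signature VERBATIM).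

On a complex manifold `M` charted on the finite-dimensional complex space `E` (model `𝓘(ℂ, E)`,
boundaryless): let `S ⊆ M` be closed, `Sg` a "bad set" at every point of which `S` is analytic, `Sg`
contained in a closed analytic set `T` all of whose regular points have codimension `≥ p + 1`, and
suppose every good point `x ∈ S ∖ Sg` is a regular point of codimension `p` of `S` (in the skeleton
this is supplied by the neighbouring stub `stub_goodPointRegular`). Then `S` is an analytic subset of
`M` and every regular point of `S` has codimension `≥ p`.

Proof ([Chirka1989, §2.3 and §5.2 Thm. 2]; [GriffithsHarrisPrinciples1978, Ch. 0 §2]):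

* analyticity is local (`Literature.Geometry.Kaehler.isAnalyticSet_iff_isClosed_and`): at a point of
  `Sg` by hypothesis, at a good point because a regular point is an analytic point (forget the
  surjectivity of the differential of the local equations);
* let `x ∈ S` be regular of codimension `q`. If `x ∈ closure (S ∖ Sg)`, regularity of codimension `q`
  propagates to nearby points (`IsRegularPointOfCodim.eventually`), among them a good point, regular of
  codimension `p`, whence `p = q` (`IsRegularPointOfCodim.codim_unique`). Otherwise `S ∩ V ⊆ Sg ⊆ T`
  for the open set `V = (closure (S ∖ Sg))ᶜ ∋ x`, and in the extended chart at `x` the submanifold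
  piece `chartImage (S ∩ V)` (codimension `q`) of the analytic set `chartImage T` (regular points of
  codimension `≥ p + 1`) would, if `q ≤ p`, carry a point `b` at which the piece is still regular of
  codimension `q` and near which the two sets agree
  (`Literature.Geometry.Kaehler.SCV.exists_isRegPt_nhds_subset_of_subset_of_le`,
  `Literature.Geometry.Kaehler.eventually_finrank_le_of_le_codim`); so `T` would have a regular
  point of codimension `q ≤ p` — absurd. This is the pattern of
  `Literature.Geometry.Kaehler.IsAnalyticSet.succ_le_codim_singularLocus` with `sng Z ⊆ Z` replaced
  by `S ∩ V ⊆ T`; at such points it even yields `p + 1 ≤ q`.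

The hypotheses `IsClosed Sg` and `Sg ⊆ S` of the registered signature are not needed by the proof.
No definitions, no named facts.
-/

set_option linter.dupNamespace false

open scoped Manifold Topology
open Set Filter Literature.Geometry.Kaehler Literature.Geometry.Kaehler.SCV Literature.Analysis.Complex.SCV

namespace Summit.HodgeConjecture.HodgeConjecture.Theorems

section Helpers

variable {E : Type*} [NormedAddCommGroup E] [NormedSpace ℂ E]
  {H : Type*} [TopologicalSpace H] {I : ModelWithCorners ℂ E H}
  {M : Type*} [TopologicalSpace M] [ChartedSpace H M]

/-- A closed set `S` which is analytic at each point of `Sg` and each of whose points off `Sg` is a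
regular point (of codimension `p`) is an analytic subset of `M`: analyticity is local
(`isAnalyticSet_iff_isClosed_and`), and a regular point is an analytic point (forget the surjectivity
of the differential of the `p` local equations). [cite: Chirka1989, §2.1 and §2.3] -/
private theorem isAnalyticSet_of_isRegularPointOfCodim_off {S Sg : Set M} {p : ℕ} (hS : IsClosed S)
    (han : ∀ x ∈ Sg, IsAnalyticSetAt I S x)
    (hgood : ∀ x ∈ S \ Sg, IsRegularPointOfCodim I S p x) : IsAnalyticSet I S := by
  refine isAnalyticSet_iff_isClosed_and.2 ⟨hS, fun x hx => ?_⟩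
  by_cases hxg : x ∈ Sg
  · exact han x hxg
  · obtain ⟨U, hU, hxU, f, hf, hSU, -⟩ := hgood x ⟨hx, hxg⟩
    exact ⟨U, hU, hxU, p, f, hf, hSU⟩

variable [FiniteDimensional ℂ E] [IsManifold I 1 M] [I.Boundaryless]

/-- At a point in the closure of the good set `S ∖ Sg` (all of whose points are regular of
codimension `p` for `S`), any codimension of regularity `q` for `S` equals `p`: regularity of
codimension `q` is an open condition (`IsRegularPointOfCodim.eventually`), so some good point nearby
is regular of both codimensions `p` and `q`, and the codimension at a point of `S` is well defined
(`IsRegularPointOfCodim.codim_unique`). [cite: Chirka1989, §2.3] -/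
private theorem codim_eq_of_mem_closure_diff {S Sg : Set M} {p q : ℕ} {x : M}
    (hgood : ∀ x ∈ S \ Sg, IsRegularPointOfCodim I S p x) (hcl : x ∈ closure (S \ Sg))
    (hq : IsRegularPointOfCodim I S q x) : p = q := by
  obtain ⟨y, hy, hyq⟩ :=
    ((mem_closure_iff_frequently.1 hcl).and_eventually hq.eventually).exists
  exact (hgood y hy).codim_unique hy.1 hyq

/-- **A submanifold piece of an analytic set inherits its codimension bound.** Let `T` be an analytic
subset of the complex manifold `M` all of whose regular points have codimension `≥ c₀`, and let
`x ∈ S` be a regular point of codimension `q` of a set `S` with `S ∩ V ⊆ T` for some open `V ∋ x`.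
Then `c₀ ≤ q`. Otherwise, in the extended chart at `x`, the submanifold piece `N = chartImage (S ∩ V)`
of `A = chartImage T` has codimension `q < c₀`, i.e. dimension at least that of `A`, so it carries a
point `b` at which `N` is still regular of codimension `q` (stability) together with an open `O ∋ b`
on which `A ∩ O ⊆ N` (`SCV.exists_isRegPt_nhds_subset_of_subset_of_le`, fed by
`eventually_finrank_le_of_le_codim`); there `A` itself is regular of codimension `q`, hence so is `T`
at the corresponding point of `M` — contradicting the bound. (The pattern of
`IsAnalyticSet.succ_le_codim_singularLocus`, with `sng Z ⊆ Z` replaced by `S ∩ V ⊆ T`.)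
[cite: Chirka1989, §5.2 Thm. 2, p. 53] -/
private theorem le_codim_of_inter_subset {S T V : Set M} {c₀ q : ℕ} {x : M}
    (hT : IsAnalyticSet I T) (hc₀ : ∀ z c, z ∈ T → IsRegularPointOfCodim I T c z → c₀ ≤ c)
    (hV : IsOpen V) (hxV : x ∈ V) (hxS : x ∈ S) (hSVT : S ∩ V ⊆ T)
    (hq : IsRegularPointOfCodim I S q x) : c₀ ≤ q := by
  by_contra hlt
  have hqc : q < c₀ := Nat.lt_of_not_le hlt
  have hqn : q ≤ Module.finrank ℂ E := hq.le_finrank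
  have hxs : x ∈ (extChartAt I x).source := mem_extChartAt_source x
  have hxT : x ∈ T := hSVT ⟨hxS, hxV⟩
  -- `x` is a regular point of codimension `q` of the piece `S ∩ V ⊆ T`
  have hqV : IsRegularPointOfCodim I (S ∩ V) q x :=
    hq.of_inter_subset hV hxV Subset.rfl inter_subset_left
  -- in the chart at `x`: the analytic set `A` and its submanifold piece `N`
  have hAz : IsZeroSetAt (chartImage I x T) (extChartAt I x x) := (hT x).isZeroSetAt_chartImage hxs
  have haA : extChartAt I x x ∈ chartImage I x T :=
    ⟨(extChartAt I x).map_source hxs, by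
      rw [mem_preimage, (extChartAt I x).left_inv hxs]; exact hxT⟩
  have haN : extChartAt I x x ∈ chartImage I x (S ∩ V) :=
    ⟨(extChartAt I x).map_source hxs, by
      rw [mem_preimage, (extChartAt I x).left_inv hxs]; exact ⟨hxS, hxV⟩⟩
  have hNA : chartImage I x (S ∩ V) ⊆ chartImage I x T := fun e he => ⟨he.1, hSVT he.2⟩
  have hNreg : IsRegPt (chartImage I x (S ∩ V)) q (extChartAt I x x) := hqV.isRegPt_chartImage hxs
  -- `N` stays regular of codimension `q` near the base point (stability, in the model space `E`)
  have hW : {e | IsRegularPointOfCodim 𝓘(ℂ, E) (chartImage I x (S ∩ V)) q e} ∈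
      𝓝 (extChartAt I x x) :=
    (isRegularPointOfCodim_iff_isRegPt.2 hNreg).eventually
  obtain ⟨b, hbN, hbW, -, O, hO, hbO, hAO⟩ := exists_isRegPt_nhds_subset_of_subset_of_le hAz haA
    (eventually_finrank_le_of_le_codim hc₀ x _) hNA haN hNreg (by omega) hW
  -- near `b` the sets `A` and `N` agree, so `b` is a regular point of codimension `q` of `A`
  have hbq : IsRegularPointOfCodim 𝓘(ℂ, E) (chartImage I x (S ∩ V)) q b := hbW
  have hbA : IsRegPt (chartImage I x T) q b := by
    refine (isRegularPointOfCodim_iff_isRegPt.1 hbq).congr hO hbO ?_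
    exact Subset.antisymm (fun e he => ⟨hNA he.1, he.2⟩) fun e he => ⟨hAO he, he.2⟩
  -- back on `M`: the corresponding point of `T` is a regular point of codimension `q < c₀` of `T`
  obtain ⟨hbt, hbT⟩ := hNA hbN
  have hzs : (extChartAt I x).symm b ∈ (extChartAt I x).source := (extChartAt I x).map_target hbt
  have hbb : b = extChartAt I x ((extChartAt I x).symm b) := ((extChartAt I x).right_inv hbt).symm
  rw [hbb] at hbA
  have hle := hc₀ _ q hbT (isRegularPointOfCodim_of_isRegPt_chartImage hzs hbA)
  exact absurd hle (not_le.2 hqc)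

end Helpers

/-- **Stub `stub_analyticOfRegularOffBad` (registered signature verbatim), CLOSED — analyticity and
codimension from regular good points.** On a complex manifold `M` charted on the finite-dimensional
complex space `E`: let `S` be closed, `Sg ⊆ S` closed, `S` analytic at every point of `Sg`, `Sg`
contained in a closed analytic set `T` all of whose regular points have codimension `≥ p + 1`, and
every point of `S ∖ Sg` a regular point of codimension `p` of `S`. Then `S` is an analytic subset of
`M` and every regular point of `S` has codimension `≥ p`. Analyticity:
`isAnalyticSet_of_isRegularPointOfCodim_off`. Codimension at a regular point `x ∈ S` of codimension
`q`: if `x ∈ closure (S ∖ Sg)` then `p = q` (`codim_eq_of_mem_closure_diff`: stability and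
uniqueness of the codimension); otherwise `S ∩ V ⊆ Sg ⊆ T` on the open `V = (closure (S ∖ Sg))ᶜ ∋ x`
and even `p + 1 ≤ q` (`le_codim_of_inter_subset`: a submanifold piece of `T` inherits the codimension
bound of `T`, [Chirka1989, §5.2 Thm. 2]). The hypotheses `IsClosed Sg`, `Sg ⊆ S` are not used.
[cite: Chirka1989, §2.3 and §5.2 Thm. 2] (see also [GriffithsHarrisPrinciples1978, Ch. 0 §2]) -/
theorem stub_analyticOfRegularOffBad : ∀ {E : Type*} [NormedAddCommGroup E] [NormedSpace ℂ E] [FiniteDimensional ℂ E] {M : Type*} [TopologicalSpace M] [ChartedSpace E M] [IsManifold 𝓘(ℂ, E) 1 M] {p : ℕ} {S Sg : Set M}, IsClosed S → IsClosed Sg → Sg ⊆ S → (∀ x ∈ Sg, Literature.Geometry.Kaehler.IsAnalyticSetAt 𝓘(ℂ, E) S x) → (∃ T : Set M, Sg ⊆ T ∧ (Literature.Geometry.Kaehler.IsAnalyticSet 𝓘(ℂ, E) T ∧ ∀ x ∈ Literature.Geometry.Kaehler.regularLocus 𝓘(ℂ, E) T, ∀ q : ℕ, Literature.Geometry.Kaehler.IsRegularPointOfCodim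 𝓘(ℂ, E) T q x → p + 1 ≤ q)) → (∀ x ∈ S \ Sg, Literature.Geometry.Kaehler.IsRegularPointOfCodim 𝓘(ℂ, E) S p x) → (Literature.Geometry.Kaehler.IsAnalyticSet 𝓘(ℂ, E) S ∧ ∀ x ∈ Literature.Geometry.Kaehler.regularLocus 𝓘(ℂ, E) S, ∀ q : ℕ, Literature.Geometry.Kaehler.IsRegularPointOfCodim 𝓘(ℂ, E) S q x → p ≤ q) := by
  intro E _ _ _ M _ _ _ p S Sg hS _hSg _hSgS han hT hgood
  refine ⟨isAnalyticSet_of_isRegularPointOfCodim_off hS han hgood, fun x hx q hq => ?_⟩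
  by_cases hcl : x ∈ closure (S \ Sg)
  · exact (codim_eq_of_mem_closure_diff hgood hcl hq).le
  · obtain ⟨T, hSgT, hTan, hTcod⟩ := hT
    have hc₀ : ∀ z c, z ∈ T → IsRegularPointOfCodim 𝓘(ℂ, E) T c z → p + 1 ≤ c :=
      fun z c hz h => hTcod z ⟨hz, c, h⟩ c h
    -- off the closure of the good set, `S` lies in `Sg ⊆ T`
    have hSV : S ∩ (closure (S \ Sg))ᶜ ⊆ T := by
      intro y hy
      by_contra hyT
      exact hy.2 (subset_closure ⟨hy.1, fun hySg => hyT (hSgT hySg)⟩)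
    exact Nat.le_of_succ_le
      (le_codim_of_inter_subset hTan hc₀ isClosed_closure.isOpen_compl hcl hx.1 hSV hq)

end Summit.HodgeConjecture.HodgeConjecture.Theorems
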